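import Mathlib
import HarnessLib
import HarnessLib.Audit
import Summits.QuantumAdvantage.Statement
import Summits.QuantumAdvantage.AdviceFreeQNC0.AdviceFreeQNC0
import Summits.QuantumAdvantage.AdviceFreeQNC0.RingHardOdd
import Summits.QuantumAdvantage.AdviceFreeQNC0.AdviceFreeQNC0Three
import Summits.QuantumAdvantage.AdviceFreeQNC0.BondTwistLocal
import Summits.QuantumAdvantage.AdviceFreeQNC0.WindowBells
import HarnessLib.Audit.Status.Attr

/-!
Route: DegreeDial

# Route DegreeDial — RingHardOdd 3 from its affine slice plus a degree lift (rung F-Q2-odd3)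

DECOMPOSITION CELL decomp-qadv (D-0178/D-0179; doctrine D-0170/0171/0172), RESIDUAL MODE, node
DegreeDial (lens decomp-qadv-lens-5-g0,
NODE 2026-08-30T01:32:47Z; critic: critic decomp-qadv-crit-1 g0 CLEARED 2026-08-30T01:35:16Z,
CRITIC-LEDGER row 1 (N ✓✓ · W ✓/NO-SHRINK · B ✓ · D PARTIAL — piece 1 carries real open difficulty,
piece 2 carries all of T above degree 1: acceptable as a rung-ladder node · E ✓ · C ✓; «CLEARED as
isolate the necessary affine slice + honest residual; shrink = piece 1 only»)). RUNG CURRENCY ONLY —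
NOTHING HERE BEARS ON THE ROOT `QuantumAdvantage := ∃ L, L ∈ BQP ∧ L ∉ BPP`;
this is a refines-child of the RUNG route DWalkThree at its blocker item stmt-QuantumAdvantage-22907
(`RingDenseResidualLt3 := R0 → A →
RingHardOdd 3`, R0 = RingFixedBellsSharp3 and A = RingBShot3 both PROVED), so the parent's open
content is the tree decl
`Summit.QuantumAdvantage.AdviceFreeQNC0.RingHardOdd 3` VERBATIM and the deciding theorem concludes
the registered rung leaf F-Q1-p3
(`AdviceFreeQNC0Three = AdviceFreeQNC0Sep 3`, advice-free QNC⁰ ⊄ FAC⁰[3]) through the landed bridge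
`adviceFreeQNC0Three_of_ringHardOdd`.
It suffices to show X = AffineCore3 ∧ AffineLift3: the AFFINE SLICE of the target's degree
quantifier (the `c = 0` slice, every output one MOD₃
gate — in the kernel EXACTLY the cell qa-qnc0's working rung `BondTwist3.RingAffineBellsLt3`,
dictionary `affineHardOdd3_iff_ringAffineBellsLt3`
proved in the lens file) AND the DEGREE LIFT from that slice to every polylog output degree with one
uniform θ.
Lean: `Summit.QuantumAdvantage.AdviceFreeQNC0.BondTwist3.RingAffineBellsLt3 ∧
(Summit.QuantumAdvantage.AdviceFreeQNC0.BondTwist3.RingAffineBellsLt3 →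
Summit.QuantumAdvantage.AdviceFreeQNC0.RingHardOdd 3)`

## Assembly
Inside `closes` (glue.lean, one line, 0 sorry): `adviceFreeQNC0Three_of_ringHardOdd (hL hA)` —
AffineLift3 applied to AffineCore3 gives the
parent's open content `RingHardOdd 3`, and the landed bridge (give away the even class,
Razborov–Smolensky, ring-frame bridge BGK) gives the rung
leaf `AdviceFreeQNC0Three`. Binders consumed: AffineCore3, AffineLift3 (cone 2). Converse T ⟹ every
piece and the seam `ringHardOdd_iff_split`
(TRIVIAL SEAM — modus ponens; flagged, informational) are lens kernel theorems (DegreeDial.lean,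
sha256 above); REFINES-READING against the parent
item verbatim: lens `refines_reading : AffineCore3 → AffineLift3 → (R0 → A → RingHardOdd 3)` for any
antecedents. The asides (QuadraticHardOdd3,
StepOneTwo3, LiftTwo3, EasyAtSqrtLog3) are banked context (kind aside: never staffed, never
counted); `affineLift3_of_steps` (writer sketch, rc 0)
is the split beneath the lift over the route decls.

CLOSES_TARGET: closes rung F-Q1-p3 of QuantumAdvantage: Summit.QuantumAdvantage.AdviceFreeQNC0.AdviceFreeQNC0Three (D-0061; not the summit Statement) — the deciding theorem of this route concludes that registered leaf instead of the Statement decl `QuantumAdvantage` (class rung: servable and labelled, never counted as concluding the summit Statement).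

Rationale: WHY THIS LINE. The target `RingHardOdd 3 = ∃ θ < 1, ∀ c, HardAt θ ((log₂ n)^c)` is a MONOTONE dial
in the output-degree schedule (lens kernel `hardAt_anti`
via `Smolensky.lowDeg_mono`), so every range split is «base slice ∧ lift»; the lens takes the base
at the bottom of the dial (`c = 0`, affine
outputs), where the cell's whole AffBells programme lives (arXiv:1704.00690 BGK relation;
BarringtonStraubingTherien1990 / doi:10.1007/BF01200404
for the MOD₃∘⊕ player; tree `AffBells37.affBellsPolyLoss3`, `BondTwist3.ringLinFormsLt3` PROVED
inside the slice), and proves in the kernel that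
the crux IMPLIES that rung (`ringAffineBellsLt3_of_ringHardOdd` — the first kernel link between the
120-file AffBells programme and the crux's own
quantifier). The lift is typed with its split beneath (`StepOneTwo3 ∧ LiftTwo3`, lens
`affineLift3_iff_steps`) and an evidence-labelled WALL
PLACEMENT: the obstruction enters at output degree 2 (a quadratic output is a MOD₃∘AND₂ gate: the
step leaves the proved depth-two two-moduli class
`Literature.Barriers.QuantumAdvantage.TwoModuliDepthTwo`, Green 2004 doi:10.1016/j.jcss.2004.01.003
being single-gate only), not at degree log n
(`NonclassicalDegreeLogBarrier` needs sub-1/√n correlation; constant θ suffices here; Bourgain 2005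
doi:10.1016/j.crma.2005.03.008). Imported area:
polynomial method / exponential sums over two moduli. Versus the parent DWalkThree and the negatives
index: the node never uses the u-walk
relaxation (`WalkHardF 3` refuted) nor a named constant (`RingHardOddHalf` refuted); versus
OddPrimeWalk: p = 3, cycle relation, no VPE.

RANKED CRUXES. #2 AffineLift3 (crux) — [DECLARED-RESIDUAL(AffineCore3) · formally WEAKER (vacuous
under T: lens kernel `affineLift3_of_ringHardOdd`; no implication to T known) · NO-SHRINK on its
own, stated honestly · split beneath (asides StepOneTwo3 ∧ LiftTwo3, lens kernel
`affineLift3_iff_steps`, writer `affineLift3_of_steps`) · leaf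
BARRIER(Literature.Barriers.QuantumAdvantage.TwoModuliDepthTwo, evasion (1) needed at the 1 → 2
step) + IDEA-NEEDED (LiftTwo3) · UNDECIDED census test: do symmetric degree-2/3 OUTPUT families beat
the best AFFINE family at N = 12…16 by an N-stable margin? (census-1 menu R58;
COSTUME-CENSUS-v1.json sha256 40a0d45d28ed66e8de90421794ca5a815b447fb107eda53892a3dd0a55da96fa) ·
critic decomp-qadv-crit-1 g0 CLEARED 2026-08-30T01:35:16Z, CRITIC-LEDGER row 1 (N ✓✓ · W ✓/NO-SHRINK
· B ✓ · D PARTIAL — piece 1 carries real open difficulty, piece 2 carries all of T above degree 1: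
acceptable as a rung-ladder node · E ✓ · C ✓; «CLEARED as isolate the necessary affine slice +
honest residual; shrink = piece 1 only») — writer instructed to file this piece with the NO-SHRINK
tag verbatim; critic's named census test for this piece: degree-2 (MOD₃∘AND₂) translation-invariant
output families vs the best affine family, N = 12–16 — no N-stable rise ⇒ evidence the cut is at the
right degree, a rise ⇒ QuadraticHardOdd3 is the real next rung and should replace piece 1 as binder]
THE BRIDGE — the affine constant-fraction core lifts to every polylog output degree with ONE uniform
constant: `RingAffineBellsLt3 → RingHardOdd 3`. [deps: AffineCore3] [difficulty: open-problem] (why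
it might fail: the 1 → 2 step needs a two-moduli correlation bound at bottom fan-in ≥ 2 (outside the
proved TwoModuliDepthTwo class; Green 2004 is single-gate) and no degree self-reduction of the ring
game is known; dense-overlap read families escape every landed (R1) form.)
[doi:10.1016/j.jcss.2004.01.003, doi:10.1016/j.crma.2005.03.008, BarringtonStraubingTherien1990,
arXiv:1704.00690]
#3 AffineCore3 (crux) — [WEAKER (evidence: T ⟹ it PROVED in the lens file,
`ringAffineBellsLt3_of_ringHardOdd` = instance c := 0 + kernel dictionary
`affineHardOdd3_iff_ringAffineBellsLt3`, DegreeDial.lean sha256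
e48bdf524db0d0b5f5f7f376a874a7cc109cd9a9002a797cdbcabf1214a77573; converse unknown — «degree ≥ 2:
nothing», AffBells37 header: the fibre method fails for ω^quadratic) · leaf ATTACKABLE (plan of
record `Exp38p2.ringAffineBellsLt3_of_thetaAligned : ThetaAligned → it`, PROVED over the analytic
box `pairAlignedHard`; `AffBells37.affBellsPolyLoss3` and `BondTwist3.ringLinFormsLt3` PROVED inside
the slice) + INSTRUMENTABLE (kit K-41P2 j336226 on stmt-22907; census-1 test NAMED, menu R58:
affine-output translation-invariant families y_k = [a₀ + Σ_{|j|≤4} a_j x_{k+j} = 1], 3^10 families,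
N ≤ 16, threshold 0.70 N-stable; COSTUME-CENSUS-v1.json sha256
40a0d45d28ed66e8de90421794ca5a815b447fb107eda53892a3dd0a55da96fa) · critic decomp-qadv-crit-1 g0
CLEARED 2026-08-30T01:35:16Z, CRITIC-LEDGER row 1 (N ✓✓ · W ✓/NO-SHRINK · B ✓ · D PARTIAL — piece 1
carries real open difficulty, piece 2 carries all of T above degree 1: acceptable as a rung-ladder
node · E ✓ · C ✓; «CLEARED as isolate the necessary affine slice + honest residual; shrink = piece 1
only»); critic ENDORSES census R58 as the named kit test · bc5 witness (tribunal T3, kernel `t3k: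
present`): `BondTwist3.ringLinFormsLt3` (WindowBells.lean) — the constant-fraction conclusion (≤ 2/3
+ ε) PROVED for the sub-family of affine outputs «tGuess ⊕ tables of ≤ (log₂N)^C common linear forms
mod 3», a rung of THIS piece outside the leaf's known regime (AdviceFreeQNC0Sep 3 is open for every
family)] THE AFFINE CORE, the cell qa-qnc0's rung decl BY NAME (dedup): affine MOD₃ bells `[⟨β_k,x⟩
= c_k]` answer the n-cycle relation on at most θ·2^(N−1) odd patterns for all large N, some θ < 1.
[difficulty: L] (why it might fail: the inverse step near-optimal ⟹ pair-aligned (ThetaAligned) has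
no precedent for two-moduli games, and dense-overlap read families («designs») escape every landed
(R1) twisted-junta bound; only θ < 1 is claimed (2/3 is attained).) [arXiv:1704.00690,
doi:10.1007/BF01200404, BarringtonStraubingTherien1990, arXiv:2209.14158]
#9 QuadraticHardOdd3 (support) — [aside · WEAKER (T ⟹ it via c := 1, n ≥ 4: lens
`quadraticHardOdd3_of_ringHardOdd`, writer sketch restates it over this inline body) · UNDECIDED
(census test: degree-2 output families vs the best affine family, N = 12…16) · the CDH ENTRY POINT
of the dial] the dial at δ ≡ 2: quadratic-output 𝔽₃-strategies (MOD₃∘AND₂ gates) are θ-hard on the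
odd class of the n-cycle relation, some θ < 1. [difficulty: open-problem]
[doi:10.1016/j.jcss.2004.01.003, arXiv:1704.00690]
#9 StepOneTwo3 (support) — [aside · the CDH entry step of the lift, output degree 1 → 2 · leaf
BARRIER(Literature.Barriers.QuantumAdvantage.TwoModuliDepthTwo, evasion (1): a two-moduli
correlation bound at bottom fan-in ≥ 2) · formally WEAKER than T (vacuous under T)] affine core ⟹
quadratic hardness. [difficulty: open-problem] [doi:10.1016/j.jcss.2004.01.003,
BarringtonStraubingTherien1990]
#9 LiftTwo3 (support) — [aside · the within-class part of the lift, degree 2 → polylog with one θ ·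
leaf IDEA-NEEDED (no degree-reduction or self-reduction of the ring game is known: random
restrictions do not lower the degree of dense 𝔽₃-polynomials, ring-length surgery does not decouple
the hidden walk) · formally WEAKER than T (vacuous under T); writer glue `affineLift3_of_steps :
StepOneTwo3 → LiftTwo3 → AffineLift3`] quadratic hardness ⟹ RingHardOdd 3. [difficulty:
open-problem] [doi:10.1016/j.crma.2005.03.008, arXiv:1704.00690]
#9 EasyAtSqrtLog3 (support) — [aside · WHERE THE DIAL FLIPS (negative endpoint, «how far the range
must NOT reach») · leaf ATTACKABLE (M-sized formalisation; memo-level proof in the lens docstring: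
base-3 digits of prefix weights by e_{3^a} (Lucas), Chernoff, the hidden endpoint and all partial
sums MOD₃-linear in the recovered prefix parities, one scoring bell among the first two cuts wins on
≥ 1 − 2n^−2 of the odd class — Razborov–Smolensky symmetric approximation) · NOT claimed by T] at
output degree √n·log₂ n some strategy wins on 1 − o(1) of the odd class, so no θ < 1 works there.
[difficulty: M] [doi:10.1145/28395.28404, doi:10.1007/BF01200404]

TWO-LAYER PLAN. AffineLift3 ⇐ StepOneTwo3 → LiftTwo3 → AffineLift3 (glue `affineLift3_of_steps`,
proved in the writer sketch) — filed as a split only if the census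
test shows a degree-2 phase transition (then StepOneTwo3 is the live child) or an idea for LiftTwo3
appears; AffineCore3 ⇐ Exp38p2.ThetaAligned
(the cell's junction conjecture; glue `Exp38p2.ringAffineBellsLt3_of_thetaAligned` PROVED) is the
cell qa-qnc0's own line, not re-filed here.
Critic note (row 1): if the census shows an N-stable rise at degree 2, QuadraticHardOdd3 is the real
next rung and should replace AffineCore3 as
binder (route edit --restate / re-cut closes to `QuadraticHardOdd3 → LiftTwo3 → leaf`).

KILL CRITERIA. A refutation of AffineCore3 (an affine-output family winning on ≥ (1 − o(1)) of the
odd class; the census test at threshold 0.70 N-stable would be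
the first signal, a proof the kill) refutes `RingHardOdd 3` itself (lens
`ringAffineBellsLt3_of_ringHardOdd`), hence the parent item 22907 and this
route: close --reason refuted:AffineCore3. A refutation of AffineLift3 (affine core true but some
polylog-degree strategy wins on 1 − o(1)) likewise
kills `RingHardOdd 3`. `RingHardOdd 3` proved elsewhere (DWalkThree 22907 closed) moots the route
(superseded --by route-QuantumAdvantage-DWalkThree).

NOT DECOMPOSED YET. LiftTwo3 (degree 2 → polylog) is one IDEA-NEEDED block: no intermediate degree
rung between 2 and (log₂ n)^c is typed because the dial census shows
no tool that distinguishes them (single-gate exponential sums die at ε·log n, far below the target;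
the obstruction is depth structure, not degree).
The loss-size dial (RingHardOdd 3 ⟹ polynomial loss for all polylog degrees, cell Cor. 38.Z′) is the
orthogonal dial of record, not this node.

CHEAPEST FALSIFIER. The census-1 test R58 restricted to AFFINE outputs: translation-invariant
families y_k = [a₀ + Σ_{|j|≤4} a_j x_{k+j} = 1] (3^10 families), exact
value by transfer operator or 2^N enumeration, N ≤ 16, a few core-h: one family exceeding 0.70
stably in N kills the sharp reading `RingTwoThirds3`
at degree 1 and is the first evidence against AffineCore3; every family ≤ 2/3 + O(2^−N) supports θ =
5/6 for the slice. Not yet run (named to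
census-1 in the NODE line; kit K-41P2 j336226 pairs/triples model is the nearest existing data: all
measured families ≤ 2/3 + O(2^−N), N ≤ 16).

NUMBERS. Value 2/3 is attained by a single deviation (sharp for `RingTwoThirds3`); the leaf needs
only some θ < 1; refuted constants: θ = 1/2
(`RingHardOddHalf`, negatives). Dial census: constant outputs / tGuess ⊕ 1_B PROVED ≤ 2/3 + o(1)
(R0); tGuess ⊕ ≤ polylog common linear forms
PROVED ≤ 2/3 + ε; affine outputs polynomial loss PROVED ≤ 1 − N^−5 (AffBells37); affine constant
loss OPEN (AffineCore3); δ ≡ 2 OPEN (CDH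
entry); δ = ε·log₂ n last point with exponentially small single-gate sums; δ = (log₂ n)^c the
target; δ = √n·log₂ n the dial FLIPS (EasyAtSqrtLog3).

DEFINITION REQUESTS. None: every constant exists (`RingHardOdd`, `BondTwist3.RingAffineBellsLt3`,
`Smolensky.lowDeg`, `RingHLF.Rel`, `OddZeros`, `AdviceFreeQNC0Three`).

Novelty: Searches (2026-08-30): tree `rg RingAffineBellsLt3 lean/Summits` (no theorem mentions RingHardOdd;
docstring mentions only), `rg RingHardOdd lean/Summits/QuantumAdvantage/AdviceFreeQNC0/AffBells*`
(nothing on RingHardOdd 3); corpus `lit search --hybrid "correlation parity quadratic polynomials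
mod 3 exponential sums constant depth"` (6 docs:
[corpus:book:jukna2012-boolean-function-complexity-advances-frontiers p.368 Razborov–Smolensky MOD_m
∉ AC⁰[p], p.342 MOD_m threshold circuits]); galaxy `lit galaxy search "parity and quadratic
polynomials|exponential sums and circuits|two moduli" --star pdf` (6 hits, none relevant); lens hits
[corpus:paper:doi-10-1016-j-jcss-2004-01-003 p.1] Green 2004,
[corpus:paper:doi-10-1016-j-crma-2005-03-008 p.3 Thm 1.1, p.5 Cor 3.1] Bourgain 2005,
[galaxy:pdf:-8264452925598198900 p.5 Thm 4] Hansen 2006.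
Nearest prior art found: the cell qa-qnc0's own rung `BondTwist3.RingAffineBellsLt3` (tree,
BondTwistLocal.lean §9 «the bottom of the degree ladder», Aug 28) and Green 2004
(doi:10.1016/j.jcss.2004.01.003: tight exponentially small correlation of ONE quadratic MOD₃ phase
with parity).
Delta: the affine slice is not new; new at crux level are the kernel dictionary `AffineHardOdd3 ↔
RingAffineBellsLt3` with the necessity `RingHardOdd 3 → RingAffineBellsLt3` (placing the AffBells
programme as the exact c = 0 slice of the crux's quantifier), the lift typed with its CDH-entry
split and wall placement at output degree 2 (not log n), and the two-sided rang  [refs: 10.1016/j.jcss.2004.01.003:, book:jukna2012-boolean-function-complexity-advances-frontiers, paper:doi-10-1016-j-jcss-2004-01-003, paper:doi-10-1016-j-crma-2005-03-008, doi:10.1016/j.jcss.2004.01.003]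

Barriers (technique_class: decomposition, two-moduli-correlation, polynomial-method): - technique_class: decomposition, two-moduli-correlation, polynomial-method
- Literature.Barriers.QuantumAdvantage.TwoModuliDepthTwo: AffineCore3 sits INSIDE its proved
technique class at bottom fan-in 1 (attackable there: `twoModuliDepthTwo_holds`, BST90 Thm 7 /
KP97); AffineLift3 must EVADE it at the 1 → 2 step (evasion (1): a two-moduli correlation bound at
bottom fan-in ≥ 2 — none in print beyond Green's single gate); tagged BARRIER on StepOneTwo3.
- Literature.Barriers.QuantumAdvantage.NonclassicalDegreeLogBarrier: does NOT bite — it caps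
correlation bounds smaller than 1/√n at degree ≥ log₂ n (`bhowmickLovett_thm31`), the target needs
only a constant θ < 1, for which Smolensky-type bounds run to degree n^(1/2−ε).
- Literature.Barriers.QuantumAdvantage.NaturalProofs: inside-and-unobstructed — bounds against
polylog-degree 𝔽₃-polynomial tuples, a class without PRFs.
- Literature.Barriers.QuantumAdvantage.Relativization: does not quantify over a fixed combinatorial
inequality on the n-cycle relation (no oracle; rung, not BQP ⊄ BPP).
- Literature.Barriers.QuantumAdvantage.Algebrization: idem — no class separation is claimed.
- Literature.Barriers.QuantumAdvantage.SeparationPrerequisites: idem — a rung leaf (advice-free QNC⁰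
⊄ FAC⁰[3]) carries no P ≠ PP floor; the node is judged in rung currency (critic rule (R)).
- Literature.Barriers.QuantumAdvantage.PromiseLiftRelativization: not in play (no promise lift).
- Literature.Barriers.QuantumAdvantage.TotalFunctionSpeedupLimit:

History (route lifecycle, newest last):
- 2026-08-30T21:43:35Z · RESIDUAL declared: AffineLift3 (stmt-QuantumAdvantage-24213) — summit-strength until shown otherwise: writer g7 schema sync (D-0170): residual flag = the route's DECLARED RESIDUAL exactly as its critic-cleared node/docstri (planner-decomp-qadv-writer-1-g7-0)

sub-problem: QuantumAdvantage · status: draft · opened planner-decomp-qadv-writer-1-g0-0 2026-08-30T01:42:57Z · rev 0 · ledger route-QuantumAdvantage-DegreeDial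
GENERATED by the gate from the ledger (D-0016/17). Provers cite these decls: `theorem foo : Summit.QuantumAdvantage.QuantumAdvantage.Theses.DegreeDial.<Decl> := …` in Summits/QuantumAdvantage/QuantumAdvantage/Theorems/<Name>.lean.
-/

namespace Summit.QuantumAdvantage.QuantumAdvantage.Theses.DegreeDial

open scoped BigOperators Topology Manifold Classical MeasureTheory ProbabilityTheory Matrix InnerProductSpace ComplexConjugate ContinuousMap
open Filter Set Function TopologicalSpace MeasureTheory

attribute [summit_statement] _root_.QuantumAdvantage
attribute [summit_statement] _root_.Summit.QuantumAdvantage.AdviceFreeQNC0.AdviceFreeQNC0Three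

open Literature.QuantumAdvantage

/-- item stmt-QuantumAdvantage-24213 · crux · RESIDUAL (gen 0; summit-strength until shown otherwise, D-0170) · leaf IDEA-NEEDED · rank 2 · open · by planner
why it might fail: the 1 → 2 step needs a two-moduli correlation bound at bottom fan-in ≥ 2 (outside the proved TwoModuliDepthTwo class; Green 2004 is single-gate) and no degree self-reduction of the ring game is known; dense-overlap read families escape every landed (R1) form.
sources: doi:10.1016/j.jcss.2004.01.003, doi:10.1016/j.crma.2005.03.008, BarringtonStraubingTherien1990, arXiv:1704.00690
[crux] [DECLARED-RESIDUAL(AffineCore3) · formally WEAKER (vacuous under T: lens kernel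
`affineLift3_of_ringHardOdd`; no implication to T known) · NO-SHRINK on its own, stated honestly ·
split beneath (asides StepOneTwo3 ∧ LiftTwo3, lens kernel `affineLift3_iff_steps`, writer
`affineLift3_of_steps`) · leaf BARRIER(Literature.Barriers.QuantumAdvantage.TwoModuliDepthTwo,
evasion (1) needed at the 1 → 2 step) + IDEA-NEEDED (LiftTwo3) · UNDECIDED census test: do symmetric
degree-2/3 OUTPUT families beat the best AFFINE family at N = 12…16 by an N-stable margin? (census-1
menu R58; COSTUME-CENSUS-v1.json sha256
40a0d45d28ed66e8de90421794ca5a815b447fb107eda53892a3dd0a55da96fa) · critic decomp-qadv-crit-1 g0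
CLEARED 2026-08-30T01:35:16Z, CRITIC-LEDGER row 1 (N ✓✓ · W ✓/NO-SHRINK · B ✓ · D PARTIAL — piece 1
carries real open difficulty, piece 2 carries all of T above degree 1: acceptable as a rung-ladder
node · E ✓ · C ✓; «CLEARED as isolate the necessary affine slice + honest residual; shrink = piece 1
only») — writer instructed to file this piece with the NO-SHRINK tag verbatim; critic's named census
test for this piece: degree-2 (MOD₃∘AND₂) translation-invariant output families vs the be -/
@[route_item "route-QuantumAdvantage-DegreeDial", crux (bottleneck := idea) (source := "ledger wanted_by.residual on stmt-QuantumAdvantage-24213, 2026-09-01")]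
def AffineLift3 : Prop :=
  Summit.QuantumAdvantage.AdviceFreeQNC0.BondTwist3.RingAffineBellsLt3 → Summit.QuantumAdvantage.AdviceFreeQNC0.RingHardOdd 3

/-- item stmt-QuantumAdvantage-24214 · crux · leaf ATTACKABLE · rank 3 · open · by planner
why it might fail: the inverse step near-optimal ⟹ pair-aligned (ThetaAligned) has no precedent for two-moduli games, and dense-overlap read families («designs») escape every landed (R1) twisted-junta bound; only θ < 1 is claimed (2/3 is attained).
sources: arXiv:1704.00690, doi:10.1007/BF01200404, BarringtonStraubingTherien1990, arXiv:2209.14158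
[crux] [WEAKER (evidence: T ⟹ it PROVED in the lens file, `ringAffineBellsLt3_of_ringHardOdd` =
instance c := 0 + kernel dictionary `affineHardOdd3_iff_ringAffineBellsLt3`, DegreeDial.lean sha256
e48bdf524db0d0b5f5f7f376a874a7cc109cd9a9002a797cdbcabf1214a77573; converse unknown — «degree ≥ 2:
nothing», AffBells37 header: the fibre method fails for ω^quadratic) · leaf ATTACKABLE (plan of
record `Exp38p2.ringAffineBellsLt3_of_thetaAligned : ThetaAligned → it`, PROVED over the analytic
box `pairAlignedHard`; `AffBells37.affBellsPolyLoss3` and `BondTwist3.ringLinFormsLt3` PROVED inside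
the slice) + INSTRUMENTABLE (kit K-41P2 j336226 on stmt-22907; census-1 test NAMED, menu R58:
affine-output translation-invariant families y_k = [a₀ + Σ_{|j|≤4} a_j x_{k+j} = 1], 3^10 families,
N ≤ 16, threshold 0.70 N-stable; COSTUME-CENSUS-v1.json sha256
40a0d45d28ed66e8de90421794ca5a815b447fb107eda53892a3dd0a55da96fa) · critic decomp-qadv-crit-1 g0
CLEARED 2026-08-30T01:35:16Z, CRITIC-LEDGER row 1 (N ✓✓ · W ✓/NO-SHRINK · B ✓ · D PARTIAL — piece 1
carries real open difficulty, piece 2 carries all of T above degree 1: acceptable as a rung-ladder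
node · E ✓ · C ✓; «CLEARED as isolate the necessary affine -/
@[route_item "route-QuantumAdvantage-DegreeDial", crux (bottleneck := work) (source := "ledger D-0171 leaf tag ATTACKABLE on stmt-QuantumAdvantage-24214, 2026-09-01")]
def AffineCore3 : Prop :=
  Summit.QuantumAdvantage.AdviceFreeQNC0.BondTwist3.RingAffineBellsLt3

/-- item stmt-QuantumAdvantage-24215 · aside · rank 9 · open · by planner
sources: doi:10.1016/j.jcss.2004.01.003, arXiv:1704.00690
[support] [aside · WEAKER (T ⟹ it via c := 1, n ≥ 4: lens `quadraticHardOdd3_of_ringHardOdd`, writer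
sketch restates it over this inline body) · UNDECIDED (census test: degree-2 output families vs the
best affine family, N = 12…16) · the CDH ENTRY POINT of the dial] the dial at δ ≡ 2:
quadratic-output 𝔽₃-strategies (MOD₃∘AND₂ gates) are θ-hard on the odd class of the n-cycle
relation, some θ < 1. [difficulty: open-problem] -/
@[route_item "route-QuantumAdvantage-DegreeDial"]
def QuadraticHardOdd3 : Prop :=
  ∃ θ : ℝ, θ < 1 ∧ ∃ n₀ : ℕ, ∀ n ≥ n₀, ∀ P : Fin n → Literature.Computability.MetaComplexity.Smolensky.CubeFn (ZMod 3) n, (∀ i, P i ∈ Literature.Computability.MetaComplexity.Smolensky.lowDeg (ZMod 3) n 2) → ((Finset.univ.filter fun x : Fin n → Bool => Summit.QuantumAdvantage.AdviceFreeQNC0.OddZeros x ∧ Literature.Computability.QuantumComplexity.RingHLF.Rel x (fun i => decide (P i x = 1))).card : ℝ) ≤ θ * (2 : ℝ) ^ (n - 1)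

/-- item stmt-QuantumAdvantage-24216 · aside · rank 9 · open · by planner
sources: doi:10.1016/j.jcss.2004.01.003, BarringtonStraubingTherien1990
[support] [aside · the CDH entry step of the lift, output degree 1 → 2 · leaf
BARRIER(Literature.Barriers.QuantumAdvantage.TwoModuliDepthTwo, evasion (1): a two-moduli
correlation bound at bottom fan-in ≥ 2) · formally WEAKER than T (vacuous under T)] affine core ⟹
quadratic hardness. [difficulty: open-problem] -/
@[route_item "route-QuantumAdvantage-DegreeDial"]
def StepOneTwo3 : Prop :=
  AffineCore3 → QuadraticHardOdd3

/-- item stmt-QuantumAdvantage-24217 · aside · rank 9 · open · by planner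
sources: doi:10.1016/j.crma.2005.03.008, arXiv:1704.00690
[support] [aside · the within-class part of the lift, degree 2 → polylog with one θ · leaf
IDEA-NEEDED (no degree-reduction or self-reduction of the ring game is known: random restrictions do
not lower the degree of dense 𝔽₃-polynomials, ring-length surgery does not decouple the hidden walk)
· formally WEAKER than T (vacuous under T); writer glue `affineLift3_of_steps : StepOneTwo3 →
LiftTwo3 → AffineLift3`] quadratic hardness ⟹ RingHardOdd 3. [difficulty: open-problem] -/
@[route_item "route-QuantumAdvantage-DegreeDial"]
def LiftTwo3 : Prop :=
  QuadraticHardOdd3 → Summit.QuantumAdvantage.AdviceFreeQNC0.RingHardOdd 3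

/-- item stmt-QuantumAdvantage-24218 · aside · rank 9 · open · by planner
sources: doi:10.1145/28395.28404, doi:10.1007/BF01200404
[support] [aside · WHERE THE DIAL FLIPS (negative endpoint, «how far the range must NOT reach») ·
leaf ATTACKABLE (M-sized formalisation; memo-level proof in the lens docstring: base-3 digits of
prefix weights by e_{3^a} (Lucas), Chernoff, the hidden endpoint and all partial sums MOD₃-linear in
the recovered prefix parities, one scoring bell among the first two cuts wins on ≥ 1 − 2n^−2 of the
odd class — Razborov–Smolensky symmetric approximation) · NOT claimed by T] at output degree √n·log₂
n some strategy wins on 1 − o(1) of the odd class, so no θ < 1 works there. [difficulty: M] -/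
@[route_item "route-QuantumAdvantage-DegreeDial"]
def EasyAtSqrtLog3 : Prop :=
  ∀ θ : ℝ, θ < 1 → ¬ (∃ n₀ : ℕ, ∀ n ≥ n₀, ∀ P : Fin n → Literature.Computability.MetaComplexity.Smolensky.CubeFn (ZMod 3) n, (∀ i, P i ∈ Literature.Computability.MetaComplexity.Smolensky.lowDeg (ZMod 3) n (Nat.sqrt n * Nat.log 2 n)) → ((Finset.univ.filter fun x : Fin n → Bool => Summit.QuantumAdvantage.AdviceFreeQNC0.OddZeros x ∧ Literature.Computability.QuantumComplexity.RingHLF.Rel x (fun i => decide (P i x = 1))).card : ℝ) ≤ θ * (2 : ℝ) ^ (n - 1))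

/-- item stmt-QuantumAdvantage-24219 · assembly · rank 1 · open · by planner
sources: arXiv:1704.00690, doi:10.1145/28395.28404
[assembly] AffineCore3 → AffineLift3 → the rung leaf AdviceFreeQNC0Three (= AdviceFreeQNC0Sep 3),
via `RingHardOdd 3` and the landed bridge `adviceFreeQNC0Three_of_ringHardOdd`; the same one-line
script as `closes`. -/
@[route_item "route-QuantumAdvantage-DegreeDial"]
def Assembly : Prop :=
  AffineCore3 → AffineLift3 → Summit.QuantumAdvantage.AdviceFreeQNC0.AdviceFreeQNC0Three

/-! D-0027 §2.1 — DECIDING THEOREM (planner-authored via `route open/edit --closes-file`; by planner-decomp-qadv-writer-1-g0-0 2026-08-30T01:42:57Z):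
its hypotheses are this route's items and its conclusion the registered leaf `Summit.QuantumAdvantage.AdviceFreeQNC0.AdviceFreeQNC0Three` (rung F-Q1-p3, D-0061) (glue_lint), and it elaborates with this file. -/

@[closes "route-QuantumAdvantage-DegreeDial"] theorem closes (hA : AffineCore3) (hL : AffineLift3) : Summit.QuantumAdvantage.AdviceFreeQNC0.AdviceFreeQNC0Three :=
  Summit.QuantumAdvantage.AdviceFreeQNC0.adviceFreeQNC0Three_of_ringHardOdd (hL hA)

end Summit.QuantumAdvantage.QuantumAdvantage.Theses.DegreeDial
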